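import Summits.BirchSwinnertonDyer.BirchSwinnertonDyer.Theorems.KolyvaginRoadThreeHalvesTamAtThreeValueContinuity
import Summits.BirchSwinnertonDyer.BirchSwinnertonDyer.Theorems.KolyvaginRoadThreeAssembly  -- buildfix 2026-08-27: the route's `closes` was re-typed (planner g32, 11:45Z: `ZhangSharpFrameAtThreeHL` + LZZ + Shimura inputs); §2's assembly-over-leaves now goes through the route's `Assembly` item (`kolyvaginRoadThree_assembly_holds`, = the former `closes` shape verbatim)
import HarnessLib

/-!
# Route `KolyvaginRoadThree`, crux `HalvesTamAtThree` (item stmt-BirchSwinnertonDyer-19155) — the crux over the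
# route's by-name LEAVES `BDPValueLeafAtThree` (19406) ∕ `IMCDivLeafAtThree` (19407) ∕ `HsiehDescentLeafAtThree`
# (19405), shared with `ClassRecordThree` by dedup

Cell `bsd-stepL` (run/shared/lean/pub/bsd-stepL/), seat `bsd-stepL-thmc-p1` (prover g3, D-0074 hands, 2026-08-26),
`--supports stmt-BirchSwinnertonDyer-19155`. Twin of `Theorems/ClassRecordThreeHalvesAtThreeLeaves.lean` for the third
K2@3 route; sequel to `Theorems/KolyvaginRoadThreeHalvesTamAtThree.lean` (g0) and
`Theorems/KolyvaginRoadThreeHalvesTamAtThreeValueContinuity.lean` (g2). Route rev 3+ of `KolyvaginRoadThree` states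
the `@[conjecture]` leaves `Three.HsiehDescentAt₃ ∕ BDPValueAt₃ ∕ IMCDivAt₃` on all of X11b@3 as by-name ASIDES with
the SAME text as `ClassRecordThree`'s (items 19405 ∕ 19406 ∕ 19407, shared).

## What this file records in the kernel

1. **The two routes' leaves are literally one statement each** (`Iff.rfl`):
   `kolyvaginRoadThree_{hsiehDescent,bdpValue,imcDiv}LeafAtThree_iff_classRecordThree`.
2. **The crux over the leaves.** `HalvesTamAtThree` ⟸ `BDPValueLeafAtThree ∧ IMCDivLeafAtThree`
   (`kolyvaginRoadThree_halvesTamAtThree_of_leaves`); ⟸ `BDPValueLeafAtThree` ∧ the registered Tamagawa H3 stub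
   `stub_imcDivTamAtThree` of item 19155 (`…_of_bdpValueLeaf_of_imcDivTamStub`); ⟸ `BDPValueLeafAtThree` ∧
   ClassRecordThree's registered stub `stub_imcDivAtThree` of item 19107 (`…_of_bdpValueLeaf_of_imcDivStub`).
   Conversely the two leaves are EXACTLY the crux plus both halves on the X11b@3 ∩ {surj} cells the crux omits —
   (ram) ∧ ¬(3 split ∧ 3 ∣ ∏c) = road (a)'s Tamagawa cells ∪ atom A1
   (`kolyvaginRoadThree_leaves_iff_halvesTamAtThree_and_rest`).
3. **The H2 leaf from the two certified H2 currencies** ((VC₃) ∕ THEOREM C typed, hypotheses verbatim):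
   `kolyvaginRoadThree_bdpValueLeafAtThree_of_valueContinuity`, `…_of_classicalFrameValue`.
4. **The route's Assembly over the three leaves** (`kolyvaginRoadThree_closes_of_leaves`): `ZhangSharpFrameAtThree →
   SchneiderTamAtThree → HsiehDescentLeafAtThree → BDPValueLeafAtThree → IMCDivLeafAtThree → EulerHalvesAtThree →
   ShimuraDisplaysAtThree → CornerAtThree → PublishedInputsKolyThree → X11b.MultiplicativeRankOneAtThree`, through the
   route's `Assembly` item (tree theorem `kolyvaginRoadThree_assembly_holds`; this was the route's `closes` verbatim until
   the 2026-08-27 re-typing of `closes` through the HL child `ZhangSharpFrameAtThreeHL` — buildfix, statement unchanged).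

HONEST FRAMING: by-name glue and equivalences only; nothing is discharged — `Three.BDPValueAt₃` (memo THEOREM C,
refereed, not kernel, not print at `3 ∥ N`) and `Three.IMCDivAt₃` (open at `p = 3`) stay OPEN; no node, label or
census count moves (T7); BSD(E,3) is proved for no class by this file.

References: [Castella2018] Camb. J. Math. 6 (2018) = arXiv:1704.06608, Thm. 3.1–3.3 (pp. 8–9), §5 (p. 12);
[McCallumLMS1991] §5; `Theses/KolyvaginRoadThree.lean` (asides 19405–19407); cell memo PROOF-BDP v1.8 §20.
-/

noncomputable section

open scoped Classical Topology

open Filter WeierstrassCurve NumberField IsDedekindDomain Field PowerSeries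
  Literature.NumberTheory.EllipticCurves Literature.NumberTheory.EllipticCurves.ModularForms
  Literature.NumberTheory.EllipticCurves.Rank1Residual
  Literature.NumberTheory.GaloisRepresentations Literature.NumberTheory.GaloisCohomology
  Summit.BirchSwinnertonDyer.Rank1Residual Summit.BirchSwinnertonDyer.Rank1Residual.X11b
  Summit.BirchSwinnertonDyer.Rank1Residual.X11b.AcSelmer
  Summit.BirchSwinnertonDyer.Rank1Residual.X11b.CongruenceLimit
  Summit.BirchSwinnertonDyer.Rank1Residual.X11b.Halves
  Summit.BirchSwinnertonDyer.Rank1Residual.X11b.Three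
  Summit.BirchSwinnertonDyer.BirchSwinnertonDyer.Theses

namespace Summit.BirchSwinnertonDyer.BirchSwinnertonDyer.Theorems

/-! ## §1 The shared leaves are one statement per leaf -/

/-- The by-name leaf `HsiehDescentLeafAtThree` of `KolyvaginRoadThree` IS `ClassRecordThree`'s (same text; one
shared item 19405 by dedup). [folklore] -/
theorem kolyvaginRoadThree_hsiehDescentLeafAtThree_iff_classRecordThree :
    KolyvaginRoadThree.HsiehDescentLeafAtThree ↔ ClassRecordThree.HsiehDescentLeafAtThree :=
  Iff.rfl

/-- The by-name leaf `BDPValueLeafAtThree` of `KolyvaginRoadThree` IS `ClassRecordThree`'s (same text; one shared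
item 19406 by dedup). [folklore] -/
theorem kolyvaginRoadThree_bdpValueLeafAtThree_iff_classRecordThree :
    KolyvaginRoadThree.BDPValueLeafAtThree ↔ ClassRecordThree.BDPValueLeafAtThree :=
  Iff.rfl

/-- The by-name leaf `IMCDivLeafAtThree` of `KolyvaginRoadThree` IS `ClassRecordThree`'s (same text; one shared
item 19407 by dedup). [folklore] -/
theorem kolyvaginRoadThree_imcDivLeafAtThree_iff_classRecordThree :
    KolyvaginRoadThree.IMCDivLeafAtThree ↔ ClassRecordThree.IMCDivLeafAtThree :=
  Iff.rfl

/-! ## §2 The crux `HalvesTamAtThree` over the leaves -/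

/-- **The crux from the two leaves**: `BDPValueLeafAtThree` (item 19406) and `IMCDivLeafAtThree` (item 19407) give
`HalvesTamAtThree` (item 19155) — the loci and Tamagawa binders are simply dropped. [folklore] -/
theorem kolyvaginRoadThree_halvesTamAtThree_of_leaves (h2 : KolyvaginRoadThree.BDPValueLeafAtThree)
    (h3 : KolyvaginRoadThree.IMCDivLeafAtThree) : KolyvaginRoadThree.HalvesTamAtThree := by
  unfold KolyvaginRoadThree.HalvesTamAtThree
  intro W _ _ hX
  exact ⟨fun _ _ _ ↦ ⟨h2 W hX, h3 W hX⟩, fun _ _ ↦ ⟨h2 W hX, h3 W hX⟩⟩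

/-- **The crux from the H2 leaf and the registered Tamagawa H3 stub**: `BDPValueLeafAtThree` and the two-loci
Tamagawa-H3 statement — verbatim the registered stub `stub_imcDivTamAtThree` of item 19155's BC3 skeleton v2
((ram) → 3 split → 3 ∣ ∏c → `IMCDivAt₃ W`; ¬(ram) → surj → `IMCDivAt₃ W`) — give `HalvesTamAtThree`. H3 is OPEN.
[cite: Castella2018, Thm. 3.3 (arXiv:1704.06608 p. 9) (shape of H3 only; open at p = 3)] -/
theorem kolyvaginRoadThree_halvesTamAtThree_of_bdpValueLeaf_of_imcDivTamStub
    (h2 : KolyvaginRoadThree.BDPValueLeafAtThree)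
    (h3 : ∀ (W : WeierstrassCurve ℚ) [W.IsElliptic] [W.IsGloballyMinimal], ClassX11b W 3 →
      (Ram W 3 → W.HasSplitMultiplicativeReductionAtPrime 3 → 3 ∣ W.tamagawaProduct → IMCDivAt₃ W) ∧
        (¬ Ram W 3 → Surj W 3 → IMCDivAt₃ W)) :
    KolyvaginRoadThree.HalvesTamAtThree := by
  unfold KolyvaginRoadThree.HalvesTamAtThree
  intro W _ _ hX
  obtain ⟨hI₁, hI₂⟩ := h3 W hX
  exact ⟨fun hr hs ht ↦ ⟨h2 W hX, hI₁ hr hs ht⟩, fun hnr hsu ↦ ⟨h2 W hX, hI₂ hnr hsu⟩⟩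

/-- **The crux from the H2 leaf and ClassRecordThree's registered H3 stub** `stub_imcDivAtThree` of item 19107
((ram) → 3 split → `IMCDivAt₃ W`; ¬(ram) → surj → `IMCDivAt₃ W`), which drops the Tamagawa binder. H3 is OPEN.
[cite: Castella2018, Thm. 3.3 (arXiv:1704.06608 p. 9) (shape of H3 only; open at p = 3)] -/
theorem kolyvaginRoadThree_halvesTamAtThree_of_bdpValueLeaf_of_imcDivStub
    (h2 : KolyvaginRoadThree.BDPValueLeafAtThree)
    (h3 : ∀ (W : WeierstrassCurve ℚ) [W.IsElliptic] [W.IsGloballyMinimal], ClassX11b W 3 →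
      (Ram W 3 → W.HasSplitMultiplicativeReductionAtPrime 3 → IMCDivAt₃ W) ∧
        (¬ Ram W 3 → Surj W 3 → IMCDivAt₃ W)) :
    KolyvaginRoadThree.HalvesTamAtThree :=
  kolyvaginRoadThree_halvesTamAtThree_of_bdpValueLeaf_of_imcDivTamStub h2 fun W _ _ hX ↦
    ⟨fun hr hs _ ↦ (h3 W hX).1 hr hs, (h3 W hX).2⟩

/-- **What the leaves add to the crux, exactly**: the pair of leaves is EQUIVALENT to `HalvesTamAtThree` together
with both halves on the X11b@3 ∩ {surj} cells the crux leaves out — a (ram) witness and NOT (3 split ∧ 3 ∣ ∏c),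
i.e. road (a)'s Tamagawa cells ∪ atom A1 (the Kolyvagin road's `ZhangSharpFrameAtThree`) — by the locus form
`kolyvaginRoadThree_halvesTamAtThree_iff`. [folklore] -/
theorem kolyvaginRoadThree_leaves_iff_halvesTamAtThree_and_rest :
    (KolyvaginRoadThree.BDPValueLeafAtThree ∧ KolyvaginRoadThree.IMCDivLeafAtThree) ↔
      KolyvaginRoadThree.HalvesTamAtThree ∧
        ∀ (W : WeierstrassCurve ℚ) [W.IsElliptic] [W.IsGloballyMinimal], ClassX11b W 3 → Surj W 3 →
          Ram W 3 → ¬ (W.HasSplitMultiplicativeReductionAtPrime 3 ∧ 3 ∣ W.tamagawaProduct) →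
            BDPValueAt₃ W ∧ IMCDivAt₃ W := by
  constructor
  · rintro ⟨h2, h3⟩
    exact ⟨kolyvaginRoadThree_halvesTamAtThree_of_leaves h2 h3, fun W _ _ hX _ _ _ ↦ ⟨h2 W hX, h3 W hX⟩⟩
  · rintro ⟨h, hA⟩
    have key : ∀ (W : WeierstrassCurve ℚ) [W.IsElliptic] [W.IsGloballyMinimal], ClassX11b W 3 → Surj W 3 →
        BDPValueAt₃ W ∧ IMCDivAt₃ W := by
      intro W _ _ hX hsurj
      by_cases hloc : Ram W 3 → W.HasSplitMultiplicativeReductionAtPrime 3 ∧ 3 ∣ W.tamagawaProduct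
      · exact kolyvaginRoadThree_halvesTamAtThree_iff.mp h W hX hsurj hloc
      · obtain ⟨hr, hn⟩ := Classical.not_imp.mp hloc
        exact hA W hX hsurj hr hn
    refine ⟨fun W _ _ hX ↦ ?_, fun W _ _ hX ↦ ?_⟩
    · by_cases hsurj : Surj W 3
      · exact (key W hX hsurj).1
      · exact bdpValueAt₃_of_not_surj W hsurj
    · by_cases hsurj : Surj W 3
      · exact (key W hX hsurj).2
      · exact imcDivAt₃_of_not_surj W hsurj

/-- **`HsiehDescentAtThree` (shared crux 19108, KolyvaginRoadThree's copy) from its leaf** `HsiehDescentLeafAtThree`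
(item 19405): the loci binders are dropped. [folklore] -/
theorem kolyvaginRoadThree_hsiehDescentAtThree_of_leaf (h : KolyvaginRoadThree.HsiehDescentLeafAtThree) :
    KolyvaginRoadThree.HsiehDescentAtThree := by
  unfold KolyvaginRoadThree.HsiehDescentAtThree
  intro W _ _ hX
  exact ⟨fun _ _ ↦ h W hX, fun _ _ ↦ h W hX⟩

/-- **The route's Assembly over the three leaves**: with the cruxes `ZhangSharpFrameAtThree`, `SchneiderTamAtThree`,
`EulerHalvesAtThree`, `ShimuraDisplaysAtThree`, `CornerAtThree`, the support `PublishedInputsKolyThree`, and the three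
by-name leaves `HsiehDescentLeafAtThree` (19405), `BDPValueLeafAtThree` (19406), `IMCDivLeafAtThree` (19407) in place
of the cruxes `HalvesTamAtThree` ∕ `HsiehDescentAtThree`, the rung-K2@3 leaf `X11b.MultiplicativeRankOneAtThree`
follows, by the route's `Assembly` item (`kolyvaginRoadThree_assembly_holds` — the route's former `closes` shape; the
current `closes` consumes the HL child `ZhangSharpFrameAtThreeHL` + `LZZWaldspurgerHeegner` + Shimura inputs instead).
CONDITIONAL on every listed hypothesis; closes nothing by itself.
[cite: Castella2018, §5 (arXiv:1704.06608 p. 12) (assembly shape at p ∣ N)] [cite: McCallumLMS1991, §5 Cor. 5.6 (p. 310)] -/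
theorem kolyvaginRoadThree_closes_of_leaves (h₁ : KolyvaginRoadThree.ZhangSharpFrameAtThree)
    (h₂ : KolyvaginRoadThree.SchneiderTamAtThree) (hD : KolyvaginRoadThree.HsiehDescentLeafAtThree)
    (h2 : KolyvaginRoadThree.BDPValueLeafAtThree) (h3 : KolyvaginRoadThree.IMCDivLeafAtThree)
    (h₅ : KolyvaginRoadThree.EulerHalvesAtThree) (h₆ : KolyvaginRoadThree.ShimuraDisplaysAtThree)
    (h₇ : KolyvaginRoadThree.CornerAtThree) (h₈ : KolyvaginRoadThree.PublishedInputsKolyThree) :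
    Summit.BirchSwinnertonDyer.Rank1Residual.X11b.MultiplicativeRankOneAtThree :=
  kolyvaginRoadThree_assembly_holds h₁ h₂ (kolyvaginRoadThree_halvesTamAtThree_of_leaves h2 h3)
    (kolyvaginRoadThree_hsiehDescentAtThree_of_leaf hD) h₅ h₆ h₇ h₈

/-! ## §3 The H2 leaf from the two certified H2 currencies: (VC₃) and THEOREM C typed -/

/-- **(VC₃) for every curve ⟹ the H2 leaf** (KolyvaginRoadThree's copy of item 19406): g2's frame-free hypothesis
`hVC` VERBATIM, through `bdpValueAt₃_of_valueContinuity`. CONDITIONAL on (VC₃) (not in print at `3 ∥ N`; memo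
THEOREM C ⟹ it); nothing booked.
[cite: Castella2018, Thm. 3.1–3.2 (arXiv:1704.06608 pp. 8–9) (display and value shape only; nothing asserted at p = 3)] -/
theorem kolyvaginRoadThree_bdpValueLeafAtThree_of_valueContinuity
    (hVC : ∀ (W : WeierstrassCurve ℚ) [W.IsElliptic] [W.IsGloballyMinimal],
      ∀ (N : ℕ) [NeZero N] (K : Type) [Field K] [NumberField K] (Dt : ModularParametrizationData W N)
      (H : HeegnerDatum N (NumberField.discr K)) (ι : K →+* ℂ) (P : (W.baseChange K).toAffine.Point),
      ClassX11b W 3 → Surj W 3 → W.conductorNorm ℤ = N → IsImaginaryQuadratic K →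
      Odd (NumberField.discr K) → SatisfiesHeegnerHypothesis N K →
      (W.quadraticTwist (NumberField.discr K : ℚ)).entireLFunction 1 ≠ 0 →
      WeierstrassCurve.Affine.Point.map ι.toRatAlgHom P = heegnerPointComplex Dt H →
      ¬ (3 : ℤ) ∣ Dt.c → ¬ IsOfFinAddOrder P →
      ∀ (κ : ZpExtension K 3), κ.IsAnticyclotomic →
        ∀ (γ : Field.absoluteGaloisGroup K) [Fact (κ.IsTopGenerator γ)]
          (𝔭 : HeightOneSpectrum (𝓞 K)) (h𝔭 : ((3 : ℕ) : 𝓞 K) ∈ 𝔭.asIdeal)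
          (he : 𝔭.asIdeal.ramificationIdx (𝓞 ℚ) = 1) (hf : 𝔭.asIdeal.inertiaDeg (𝓞 ℚ) = 1),
          ∀ (f : CuspForm (CongruenceSubgroup.Gamma0 N) 2), IsNewformOf W f →
            ∀ (ι' : PadicAlgCl 3 ≃+* ℂ), InducesPrime ι' 𝔭 →
              ∃ (ΩK : ℂ) (Ωp : ℂ_[3]) (u : (unrIntegers 3)ˣ), ΩK ≠ 0 ∧ Ωp ≠ 0 ∧
                ∀ (φ : ℕ → HeckeCharacter K) (n : ℕ → ℕ) (r : ℕ → FramedGaloisRep K (PadicAlgCl 3) 1),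
                  (∀ k, 0 < n k) → (∀ k (v : HeightOneSpectrum (𝓞 K)), (φ k).IsUnramifiedAt v) →
                  (∀ k, (φ k).HasInfinityType (fun _ ↦ (n k : ℤ)) (fun _ ↦ -(n k : ℤ))) →
                  (∀ k, IsPAdicAvatarOf ι' (φ k) (r k)) → (∀ k, FactorsThroughZp κ (r k)) →
                  Tendsto (fun k ↦ avatarValueAt (r k) γ) atTop (𝓝 1) →
                  Tendsto (fun k ↦ ((ι'.symm (bdpInterpolationValue 3 f 𝔭 (φ k) (n k) ΩK) :
                    PadicAlgCl 3) : ℂ_[3]) * Ωp ^ (4 * n k)) atTop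
                    (𝓝 (((u : unrIntegers 3) : ℂ_[3]) *
                      (algebraMap ℚ_[3] ℂ_[3] (((1 : ℚ_[3]) - ((W.LFunction 3 : ℤ) : ℚ_[3]) *
                        (3 : ℚ_[3])⁻¹) * logOmega W 3 (embAt K 3 𝔭 h𝔭 he hf) P)) ^ 2))) :
    KolyvaginRoadThree.BDPValueLeafAtThree :=
  fun W _ _ _ ↦ bdpValueAt₃_of_valueContinuity (hVC W)

/-- **THEOREM C typed for every curve ⟹ the H2 leaf** (KolyvaginRoadThree's copy of item 19406): g0's hypothesis
`hC` VERBATIM, through `bdpValueAt₃_of_classicalFrameValue`. CONDITIONAL on THEOREM C typed (memo-proved, refereed;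
not kernel, not print at `3 ∥ N`). [cite: Castella2018, Thm. 3.2 (arXiv:1704.06608 p. 9) (shape only; antecedent = PROOF-BDP §20 THEOREM C)] -/
theorem kolyvaginRoadThree_bdpValueLeafAtThree_of_classicalFrameValue
    (hC : ∀ (W : WeierstrassCurve ℚ) [W.IsElliptic] [W.IsGloballyMinimal],
      ∀ (N : ℕ) [NeZero N] (K : Type) [Field K] [NumberField K] (Dt : ModularParametrizationData W N)
      (H : HeegnerDatum N (NumberField.discr K)) (ι : K →+* ℂ) (P : (W.baseChange K).toAffine.Point),
      ClassX11b W 3 → Surj W 3 → W.conductorNorm ℤ = N → IsImaginaryQuadratic K →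
      Odd (NumberField.discr K) → SatisfiesHeegnerHypothesis N K →
      (W.quadraticTwist (NumberField.discr K : ℚ)).entireLFunction 1 ≠ 0 →
      WeierstrassCurve.Affine.Point.map ι.toRatAlgHom P = heegnerPointComplex Dt H →
      ¬ (3 : ℤ) ∣ Dt.c → ¬ IsOfFinAddOrder P →
      ∀ (κ : ZpExtension K 3), κ.IsAnticyclotomic →
        ∀ (γ : Field.absoluteGaloisGroup K) [Fact (κ.IsTopGenerator γ)]
          (𝔭 : HeightOneSpectrum (𝓞 K)) (h𝔭 : ((3 : ℕ) : 𝓞 K) ∈ 𝔭.asIdeal)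
          (he : 𝔭.asIdeal.ramificationIdx (𝓞 ℚ) = 1) (hf : 𝔭.asIdeal.inertiaDeg (𝓞 ℚ) = 1),
          ∀ (f : CuspForm (CongruenceSubgroup.Gamma0 N) 2), IsNewformOf W f →
            ∀ (ι' : PadicAlgCl 3 ≃+* ℂ), InducesPrime ι' 𝔭 →
              ∃ (ΩK : ℂ) (Ωp : (unrIntegers 3)ˣ) (L : UnrSeries 3),
                ΩK ≠ 0 ∧ IsBDPLFunction ι' 𝔭 κ γ f ΩK ((Ωp : unrIntegers 3) : ℂ_[3]) L ∧
                ∃ u : (unrIntegers 3)ˣ, L.HasValueAt 0 (((u : unrIntegers 3) : ℂ_[3]) *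
                  (algebraMap ℚ_[3] ℂ_[3] (((1 : ℚ_[3]) - ((W.LFunction 3 : ℤ) : ℚ_[3]) * (3 : ℚ_[3])⁻¹) *
                    logOmega W 3 (embAt K 3 𝔭 h𝔭 he hf) P)) ^ 2)) :
    KolyvaginRoadThree.BDPValueLeafAtThree :=
  fun W _ _ _ ↦ bdpValueAt₃_of_classicalFrameValue hC W

end Summit.BirchSwinnertonDyer.BirchSwinnertonDyer.Theorems

end
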